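import Literature.AlgebraicGeometry.AbelianSchemes.AbelianSchemeHomDescentEquivariant
import HarnessLib

/-!
# Two fppf homomorphisms out of an abelian scheme with the SAME kernel are isomorphic under it — no degree count

Topic `Literature/AlgebraicGeometry/AbelianSchemes`, namespace `Literature.AlgebraicGeometry.AbelianSchemes.AbelianSchemeOver` (THEOREMS ONLY; no definition, no named fact,
no `sorry`, no `instance`, no notation).  Cell `hodgecm-mathlib`, F0/P6 «MOD», a rank-free companion of ★ `AbelianSchemeHomDescentFlatSurjective` §3
(`exists_iso_comp_eq_of_forall_comp_eq_one`: ONE kernel inclusion + EQUAL constant ranks) and of ★ (ST-2b) `AbelianSchemeHomDescentEquivariant`: when BOTH kernel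
inclusions are known on points (`t ≫ ψ = 1 ↔ t ≫ φ = 1`) and both `ψ`, `φ` are flat surjective quasi-compact homomorphisms, no rank hypothesis is needed — descend each
through the other (★ `existsUnique_comp_eq_of_forall_comp_eq_one`) and cancel the epimorphisms.  Consumers: ★ (ST-2F) `SerreTensorFrobeniusTwist` ∕ the σ2 spine when the
block computation gives `Ker F_{A/k,q} = A[𝔭]` (or `= Ker ι(π₀)`, FROB₀) as an EQUALITY of subgroup functors; `--supports stmt-HodgeConjecture-24832`, count-neutral.
HC_CM is proved only modulo the 2 remaining named inputs (hLiu418, h413) until rung 0 closes; this file discharges none of them.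

## Contents

* §1 **`exists_iso_comp_eq_of_comp_eq_one_iff`** — `ψ : A → C`, `φ : A → B` fppf homomorphisms with `t ≫ ψ = 1 ↔ t ≫ φ = 1` for all points `t` ⇒
  `∃ e : C ≅ B, ψ ≫ e = φ`, `e` a homomorphism, unique.
* §2 **`exists_iso_comp_eq_equivariant_of_comp_eq_one_iff`** — the same with `𝒪`-actions: `ψ`, `φ` equivariant ⇒ `e` equivariant (★ `comp_iso_eq_iso_comp_of_endo`).

## References
* [MumfordAV1970] D. Mumford, *Abelian Varieties* (1970), §7 Thm. 4 (p. 72) (isogenies out of `A` ↔ finite subgroups; equal kernels ⇒ isomorphic quotients).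
* [SGA1] A. Grothendieck, *SGA 1*, Exp. VIII Thm. 5.2 (fpqc descent of morphisms).
* Tree: ★ `AbelianSchemeHomDescentFlatSurjective`, ★ `AbelianSchemeHomDescentEquivariant`.
-/

noncomputable section

universe u

open CategoryTheory CategoryTheory.Limits AlgebraicGeometry MonoidalCategory CartesianMonoidalCategory
open scoped MonObj

namespace Literature.AlgebraicGeometry.AbelianSchemes

namespace AbelianSchemeOver

variable {S : Scheme.{u}} (A : AbelianSchemeOver S) {B C : AbelianSchemeOver S} (ψ : A.X ⟶ C.X) (φ : A.X ⟶ B.X)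
  [IsMonHom ψ] [IsMonHom φ] [Flat ψ.left] [Surjective ψ.left] [QuasiCompact ψ.left] [Flat φ.left] [Surjective φ.left] [QuasiCompact φ.left]

/-! ## §1 Equal kernels ⇒ isomorphic under `A` -/

/-- **EQUAL KERNELS ⇒ ISOMORPHIC QUOTIENTS, no degree count** ([MumfordAV1970] §7 Thm. 4): let `ψ : A → C` and `φ : A → B` be homomorphisms of abelian schemes whose
underlying maps are flat, surjective and quasi-compact, with the SAME kernel on points: `t ≫ ψ = 1 ↔ t ≫ φ = 1` for every `T`-valued point `t` of `A`.  Then there is an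
isomorphism `e : C ≅ B` over `S` with `ψ ≫ e = φ`; it is a homomorphism and the unique factorisation.  (Descend `φ` through `ψ` and `ψ` through `φ`; the two composites
are the identity by cancelling the epimorphisms `ψ.left`, `φ.left`.) [cite: MumfordAV1970, §7 Thm. 4 (p. 72)] [cite: SGA1, Exp. VIII Thm. 5.2] -/
theorem exists_iso_comp_eq_of_comp_eq_one_iff (hker : ∀ ⦃T : Over S⦄ (t : T ⟶ A.X), t ≫ ψ = 1 ↔ t ≫ φ = 1) :
    ∃ e : C.X ≅ B.X, ψ ≫ e.hom = φ ∧ IsMonHom e.hom ∧ ∀ χ : C.X ⟶ B.X, ψ ≫ χ = φ → χ = e.hom := by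
  obtain ⟨χ, hχ, huniq⟩ := A.existsUnique_comp_eq_of_forall_comp_eq_one ψ φ fun T t ht => (hker t).1 ht
  obtain ⟨χ', hχ', -⟩ := A.existsUnique_comp_eq_of_forall_comp_eq_one φ ψ fun T t ht => (hker t).2 ht
  have h1 : χ ≫ χ' = 𝟙 C.X := by
    apply A.cancel_left_of_flat_surjective ψ
    rw [← Category.assoc, hχ, hχ', Category.comp_id]
  have h2 : χ' ≫ χ = 𝟙 B.X := by
    apply A.cancel_left_of_flat_surjective φ
    rw [← Category.assoc, hχ', hχ, Category.comp_id]
  exact ⟨⟨χ, χ', h1, h2⟩, hχ, A.isMonHom_of_comp_eq ψ φ hχ, fun χ₁ hχ₁ => huniq χ₁ hχ₁⟩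

omit [IsMonHom ψ] [IsMonHom φ] [Flat ψ.left] [Surjective ψ.left] [QuasiCompact ψ.left] [Flat φ.left] [Surjective φ.left] [QuasiCompact φ.left] in
/-- … and the inverse composes the other way: `φ ≫ e.inv = ψ`. [cite: MumfordAV1970, §7 Thm. 4 (p. 72)] -/
theorem comp_inv_eq_of_comp_hom_eq (e : C.X ≅ B.X) (he : ψ ≫ e.hom = φ) : φ ≫ e.inv = ψ := by
  rw [← he, Category.assoc, e.hom_inv_id, Category.comp_id]

/-! ## §2 With `𝒪`-actions: the isomorphism is equivariant -/

variable {A} {O : Type*} [CommRing O] (actA : A.RingAction O) (actB : B.RingAction O) (actC : C.RingAction O)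

/-- **EQUAL KERNELS ⇒ ISOMORPHIC AS `𝒪`-ABELIAN SCHEMES**: in §1, if `ψ` and `φ` are `𝒪`-equivariant (`ι_A(a) ≫ ψ = ψ ≫ ι_C(a)`, `ι_A(a) ≫ φ = φ ≫ ι_B(a)`), the
isomorphism `e` is `𝒪`-equivariant: `ι_C(a) ≫ e = e ≫ ι_B(a)` (★ `comp_iso_eq_iso_comp_of_endo`). [cite: MumfordAV1970, §7 Thm. 4 (p. 72)] [cite: SGA1, Exp. VIII Thm. 5.2] -/
theorem exists_iso_comp_eq_equivariant_of_comp_eq_one_iff (hψ : ∀ a, actA.i a ≫ ψ = ψ ≫ actC.i a) (hφ : ∀ a, actA.i a ≫ φ = φ ≫ actB.i a)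
    (hker : ∀ ⦃T : Over S⦄ (t : T ⟶ A.X), t ≫ ψ = 1 ↔ t ≫ φ = 1) :
    ∃ e : C.X ≅ B.X, ψ ≫ e.hom = φ ∧ IsMonHom e.hom ∧ (∀ a, actC.i a ≫ e.hom = e.hom ≫ actB.i a) ∧
      ∀ χ : C.X ⟶ B.X, ψ ≫ χ = φ → χ = e.hom := by
  obtain ⟨e, he, hmon, huniq⟩ := A.exists_iso_comp_eq_of_comp_eq_one_iff ψ φ hker
  exact ⟨e, he, hmon, fun a => (A.comp_iso_eq_iso_comp_of_endo ψ e he (hψ a) (hφ a)).1, huniq⟩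

end AbelianSchemeOver

end Literature.AlgebraicGeometry.AbelianSchemes

end
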